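import Mathlib

/-!
# Border apolarity, support item `BorelFixedBorderApolarity` — digits: generic weights from a large base

Route `ValiantsHypothesis/BorderApolarity`, support item `stmt-ValiantsHypothesis-5781`, helper
file (weights, part A).  Elementary bookkeeping used to build the GENERIC anti-dominant cocharacter
of the torus of `H₀`: if every variable `v` gets the weight `R^{g₁ v} (+ R^{g₂ v})` for a base `R`
exceeding all exponent digits, then the weight `Σ_v e_v μ_v` of a monomial `x^e` of small degree is
a base-`R` numeral whose digits are the sums of `e` over the fibres of `g₁`, `g₂`
(`bfba_weight_eq_digitSum`, `bfba_digit_le`), and base-`R` numerals with digits `< R` determine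
their digits (`bfba_digits_inj`).  Folklore arithmetic.
-/

open scoped BigOperators

namespace Summit.ValiantsHypothesis.ValiantsHypothesis.Theorems.BorderApolarityBorelFixedBorderApolarity

set_option linter.dupNamespace false

/-- **Uniqueness of base-`R` digits.**  If `Σ_{q<Q} x_q R^q = Σ_{q<Q} y_q R^q` with all digits
`< R`, then `x_q = y_q` for `q < Q` (peel off the lowest digit modulo `R` and divide). [folklore] -/
theorem bfba_digits_inj (R : ℕ) (hR : 0 < R) :
    ∀ (Q : ℕ) (x y : ℕ → ℕ), (∀ q, x q < R) → (∀ q, y q < R) →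
      ∑ q ∈ Finset.range Q, x q * R ^ q = ∑ q ∈ Finset.range Q, y q * R ^ q →
      ∀ q, q < Q → x q = y q := by
  intro Q
  induction Q with
  | zero => intro x y _ _ _ q hq; omega
  | succ Q ih =>
    intro x y hx hy h q hq
    rw [Finset.sum_range_succ', Finset.sum_range_succ'] at h
    simp only [pow_zero, mul_one, pow_succ] at h
    have hxs : ∑ k ∈ Finset.range Q, x (k + 1) * (R ^ k * R) = R * ∑ k ∈ Finset.range Q, x (k + 1) * R ^ k := by
      rw [Finset.mul_sum]
      exact Finset.sum_congr rfl fun k _ => by ring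
    have hys : ∑ k ∈ Finset.range Q, y (k + 1) * (R ^ k * R) = R * ∑ k ∈ Finset.range Q, y (k + 1) * R ^ k := by
      rw [Finset.mul_sum]
      exact Finset.sum_congr rfl fun k _ => by ring
    rw [hxs, hys] at h
    -- lowest digit
    have h0 : x 0 = y 0 := by
      have h1 := congrArg (· % R) h
      rw [add_comm, Nat.mul_add_mod, add_comm, Nat.mul_add_mod, Nat.mod_eq_of_lt (hx 0),
        Nat.mod_eq_of_lt (hy 0)] at h1
      exact h1
    rw [h0, add_left_inj] at h
    have h2 : ∑ k ∈ Finset.range Q, x (k + 1) * R ^ k = ∑ k ∈ Finset.range Q, y (k + 1) * R ^ k :=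
      Nat.eq_of_mul_eq_mul_left hR h
    have ih' := ih (fun k => x (k + 1)) (fun k => y (k + 1)) (fun k => hx _) (fun k => hy _) h2
    rcases q with _ | q
    · exact h0
    · exact ih' q (by omega)

section Digits

variable {σ : Type} [Fintype σ]

/-- **A two-exponent weight is a base-`R` numeral.**  With `μ_v = R^{g₁ v} + [blk v] R^{g₂ v}` and
all exponents `< Q`: `Σ_v e_v μ_v = Σ_{q<Q} dig_q(e) R^q` where
`dig_q(e) = Σ_{g₁ v = q} e_v + Σ_{blk v, g₂ v = q} e_v`. [folklore] -/
theorem bfba_weight_eq_digitSum (g₁ g₂ : σ → ℕ) (blk : σ → Prop) [DecidablePred blk] (R Q : ℕ)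
    (hg₁ : ∀ v, g₁ v < Q) (hg₂ : ∀ v, blk v → g₂ v < Q) (e : σ → ℕ) :
    ∑ v, e v * (R ^ g₁ v + if blk v then R ^ g₂ v else 0) =
      ∑ q ∈ Finset.range Q,
        ((∑ v ∈ Finset.univ.filter (fun v => g₁ v = q), e v) +
          ∑ v ∈ Finset.univ.filter (fun v => blk v ∧ g₂ v = q), e v) * R ^ q := by
  classical
  have h1 : ∑ v, e v * R ^ g₁ v =
      ∑ q ∈ Finset.range Q, (∑ v ∈ Finset.univ.filter (fun v => g₁ v = q), e v) * R ^ q := by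
    rw [← Finset.sum_fiberwise_of_maps_to (s := Finset.univ) (t := Finset.range Q) (g := g₁)
      (fun v _ => Finset.mem_range.2 (hg₁ v))]
    refine Finset.sum_congr rfl fun q _ => ?_
    rw [Finset.sum_mul]
    refine Finset.sum_congr rfl fun v hv => ?_
    rw [(Finset.mem_filter.1 hv).2]
  have h2 : ∑ v, e v * (if blk v then R ^ g₂ v else 0) =
      ∑ q ∈ Finset.range Q, (∑ v ∈ Finset.univ.filter (fun v => blk v ∧ g₂ v = q), e v) * R ^ q := by
    have h3 : ∑ v, e v * (if blk v then R ^ g₂ v else 0) =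
        ∑ v ∈ Finset.univ.filter blk, e v * R ^ g₂ v := by
      rw [Finset.sum_filter]
      refine Finset.sum_congr rfl fun v _ => ?_
      split_ifs <;> simp
    rw [h3, ← Finset.sum_fiberwise_of_maps_to (s := Finset.univ.filter blk) (t := Finset.range Q)
      (g := g₂) (fun v hv => Finset.mem_range.2 (hg₂ v (Finset.mem_filter.1 hv).2))]
    refine Finset.sum_congr rfl fun q _ => ?_
    rw [Finset.sum_mul, Finset.filter_filter]
    refine Finset.sum_congr rfl fun v hv => ?_
    rw [(Finset.mem_filter.1 hv).2.2]
  simp only [mul_add, Finset.sum_add_distrib, add_mul]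
  rw [h1, h2]

/-- **Digits are small**: if no block variable has `g₁ v = g₂ v`, each digit is at most
`Σ_v e_v`. [folklore] -/
theorem bfba_digit_le (g₁ g₂ : σ → ℕ) (blk : σ → Prop) [DecidablePred blk]
    (hne : ∀ v, blk v → g₁ v ≠ g₂ v) (e : σ → ℕ) (q : ℕ) :
    (∑ v ∈ Finset.univ.filter (fun v => g₁ v = q), e v) +
        ∑ v ∈ Finset.univ.filter (fun v => blk v ∧ g₂ v = q), e v ≤ ∑ v, e v := by
  classical
  rw [← Finset.sum_union]
  · exact Finset.sum_le_sum_of_subset (Finset.union_subset (Finset.filter_subset _ _)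
      (Finset.filter_subset _ _))
  · rw [Finset.disjoint_left]
    intro v hv1 hv2
    have h1 := (Finset.mem_filter.1 hv1).2
    have h2 := (Finset.mem_filter.1 hv2).2
    exact hne v h2.1 (h1.trans h2.2.symm)

end Digits

/-! ## Small weight facts -/

/-- The position `v.1 * m + v.2` determines `v`. [folklore] -/
theorem bfba_lin_injective {m : ℕ} (u v : Fin m × Fin m)
    (h : (u.1 : ℕ) * m + (u.2 : ℕ) = (v.1 : ℕ) * m + (v.2 : ℕ)) : u = v := by
  have hm : 0 < m := Fin.pos u.1
  have h1 : ((u.2 : ℕ) + (u.1 : ℕ) * m) / m = ((v.2 : ℕ) + (v.1 : ℕ) * m) / m := by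
    rw [add_comm, h, add_comm]
  rw [Nat.add_mul_div_right _ _ hm, Nat.add_mul_div_right _ _ hm,
    Nat.div_eq_of_lt u.2.isLt, Nat.div_eq_of_lt v.2.isLt, zero_add, zero_add] at h1
  have h2 : ((u.2 : ℕ) + (u.1 : ℕ) * m) % m = ((v.2 : ℕ) + (v.1 : ℕ) * m) % m := by
    rw [add_comm, h, add_comm]
  rw [Nat.add_mul_mod_self_right, Nat.add_mul_mod_self_right, Nat.mod_eq_of_lt u.2.isLt,
    Nat.mod_eq_of_lt v.2.isLt] at h2
  exact Prod.ext (Fin.ext h1) (Fin.ext h2)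

/-- The weight of an exponent for an integer-valued natural weight, as a natural number sum over
all variables. [folklore] -/
theorem bfba_weight_natCast {σ : Type} [Fintype σ] (μn : σ → ℕ) (e : σ →₀ ℕ) :
    Finsupp.weight (fun v => (μn v : ℤ)) e = ((∑ v, e v * μn v : ℕ) : ℤ) := by
  rw [Finsupp.weight_apply, Finsupp.sum]
  rw [Finset.sum_subset (Finset.subset_univ e.support)
    (fun v _ hv => by rw [Finsupp.notMem_support_iff.1 hv, zero_smul])]
  push_cast
  exact Finset.sum_congr rfl fun v _ => by rw [nsmul_eq_mul]

/-- `Σ_v e_v = deg e`. [folklore] -/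
theorem bfba_sum_eq_degree {σ : Type} [Fintype σ] (e : σ →₀ ℕ) : ∑ v, e v = e.degree := by
  rw [Finsupp.degree_apply]
  exact (Finset.sum_subset (Finset.subset_univ _) fun v _ hv => by
    simpa using hv).symm

/-- Weights are nonnegative for a nonnegative weight vector. [folklore] -/
theorem bfba_weight_nonneg {σ : Type} (μ : σ → ℤ) (hμ0 : ∀ v, 0 ≤ μ v) (e : σ →₀ ℕ) :
    0 ≤ Finsupp.weight μ e := by
  rw [Finsupp.weight_apply, Finsupp.sum]
  exact Finset.sum_nonneg fun v _ => nsmul_nonneg (hμ0 v) _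

end Summit.ValiantsHypothesis.ValiantsHypothesis.Theorems.BorderApolarityBorelFixedBorderApolarity
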